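import Literature.Algebra.Polynomial.CasasAlvero.Degree7Char127
import Literature.Algebra.Polynomial.CasasAlvero.Transfer
import Mathlib.Tactic.NormNum.Prime
import HarnessLib

/-!
# Casas-Alvero in the degrees `7·127^k` over every field of characteristic `0`

[CastryckLaterveerOunaies2012, Thm. 4] (with [GrafVonBothmerEtAl2007, Props. 2, 6]): `127` is a good prime for degree `7`, hence the
Casas-Alvero conjecture holds in characteristic `0` in every degree `7·127^k`.  Here this is a THEOREM of the tree: `CA_{7·127^k}` holds over every
field of characteristic `127` (`Degree7Char127.lean`, kernel-checked scenario certificates) and the GvBLSW transfer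
`holdsInDegree_of_charP_of_charZero` (`Transfer.lean`) moves it to characteristic `0`.  The degree `7 = 7¹` itself was already covered
(prime power); the smallest NEW characteristic-`0` degree is `889 = 7·127` — not of the form `a·p^k` with `a ≤ 6`, so outside every
previously landed characteristic-`0` family of this directory.  No `sorry`, no new axioms.
-/

noncomputable section

open Polynomial

universe u

namespace Literature.Algebra.Polynomial.CasasAlvero

variable (K : Type u) [Field K] [CharZero K]

/-- **Degree `7·127^k` in characteristic `0`**: `127` is a good prime for degree `7` (a Lean theorem here:
`holdsInDegree_seven_mul_pow_of_char_127`), so `CA_{7·127^k}` holds over every field of characteristic `0`.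
[cite: CastryckLaterveerOunaies2012, Thm. 4] [cite: GrafVonBothmerEtAl2007, Prop. 6] -/
theorem holdsInDegree_seven_mul_pow_of_charZero (k : ℕ) : HoldsInDegree K (7 * 127 ^ k) := by
  haveI : Fact (Nat.Prime 127) := ⟨by norm_num⟩
  exact holdsInDegree_of_charP_of_charZero 127 (fun F _ _ => holdsInDegree_seven_mul_pow_of_char_127 (K := F) k) K

/-- The smallest new characteristic-`0` degree this gives: `889 = 7·127`. [cite: CastryckLaterveerOunaies2012, Thm. 4] -/
theorem holdsInDegree_889_of_charZero : HoldsInDegree K 889 := by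
  simpa using holdsInDegree_seven_mul_pow_of_charZero K 1

end Literature.Algebra.Polynomial.CasasAlvero
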